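import Literature.Computability.AlgebraicComplexity.LMR13PermanentNotTangentThree
import Literature.RepresentationTheory.FiniteGroups.SymmetricGroupFourTermClassFunctions
import HarnessLib

/-!
# Landsberg–Manivel–Ressayre 2013, Prop. 3.4.2: the case `n = 3` PROVED, and the assembly
# `Lemma 3.4.1 ⇒ Prop. 3.4.2` for all `n ≥ 3`

Cell `val-lit`, row `LMR13-A` (val-lit-p8 g3). Honest framing: bookkeeping inside the typed
literature of LMR 2013; VP ≠ VNP is NOT proved and nothing here is progress on it.

The named fact `LMR2013_prop_3_4_2` (`LMR13DualVarieties.lean`) says, for every `n ≥ 3` and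
`λ ⊢ n`: `IM_λ ∈ T̂_{[det_n]}𝒟ual_{2n−2,n,n²}` iff `λ = (1ⁿ)` or `λ = (2,1^{n−2})`. Its `⇐` half is
PROVED (`LMR2013_prop_3_4_2_mpr`, val-lit-t11, `LMR13ImmanantsTangent.lean`), so the fact is equivalent
to its `⇒` half (`LMR2013_prop_3_4_2_iff_subset`). This file closes what can be closed today:

* `parts_eq_of_partition_three` — a partition of `3` is `(3)`, `(2,1)` or `(1,1,1)`;
* **`LMR2013_prop_3_4_2_three`** — **Prop. 3.4.2 at `n = 3`, PROVED** unconditionally: the only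
  other partition `(3)` has `IM_{(3)} = per_3 ∉ T̂` by the kernel certificate
  `perPoly_not_mem_lmrZariskiTangent_three` (`LMR13PermanentNotTangentThree.lean`). (The printed
  proof does not cover `n = 3`: Lemma 3.4.1 needs four distinct indices.)
* **`LMR2013_prop_3_4_2_of_lemma_3_4_1`** — for `n ≥ 4` the printed route: IF Lemma 3.4.1 holds in
  the typed form "`IM_λ ∈ T̂ ⇒ χ_λ ∈ C_n`" (`fourTermClassFunctions`,
  `SymmetricGroupFourTermClassFunctions.lean`; this is item (X7) of the cell, not yet in the tree),
  THEN `LMR2013_prop_3_4_2` holds — by `spechtCharacter_mem_fourTermClassFunctions_iff` (`dim C_n = 2`,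
  val-lit-p8) for `n ≥ 4` and `LMR2013_prop_3_4_2_three` for `n = 3`. So the named fact now hinges
  on exactly one typed statement, Lemma 3.4.1.

## References
* [LandsbergManivelRessayre2013] J. M. Landsberg, L. Manivel, N. Ressayre, *Hypersurfaces with
  degenerate duals and the Geometric Complexity Theory Program*, Comment. Math. Helv. 88 (2013)
  469–484, Lemma 3.4.1 and Proposition 3.4.2 (pp. 479–480).
-/

noncomputable section

namespace Literature.Computability.AlgebraicComplexity

open _root_.Literature.NumberTheory.DiophantineGeometry (spechtCharacter)
open _root_.Literature.RepresentationTheory.FiniteGroups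

/-- The partitions of `3` are `(3)`, `(2,1)` and `(1,1,1)`. [cite: Macdonald1995, I §1 (p. 1)] -/
theorem parts_eq_of_partition_three (lam : Nat.Partition 3) :
    lam.parts = {3} ∨ lam.parts = Multiset.replicate 3 1 ∨
      lam.parts = 2 ::ₘ Multiset.replicate (3 - 2) 1 := by
  have hcoe : lam.parts = (lam.sortedParts : Multiset ℕ) := (Multiset.sort_eq _ _).symm
  by_cases h : ∃ a ∈ lam.parts, 2 ≤ a
  · obtain ⟨a, ha, ha2⟩ := h
    rcases sortedParts_of_exists_large_part lam ha (by omega) with h3 | h21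
    · left
      rw [hcoe, h3]
      rfl
    · right; right
      rw [hcoe, h21]
      rfl
  · push Not at h
    have hcard : 3 ≤ lam.parts.card + 1 := by
      have hall : ∀ b ∈ lam.parts, b = 1 := fun b hb => by
        have := lam.parts_pos hb
        have := h b hb
        omega
      have hrep : lam.parts = Multiset.replicate lam.parts.card 1 := Multiset.eq_replicate.2 ⟨rfl, hall⟩
      have hsum := lam.parts_sum
      rw [hrep, Multiset.sum_replicate, smul_eq_mul, mul_one] at hsum
      omega
    rcases sortedParts_of_card_parts_ge lam hcard with h111 | h21
    · right; left
      rw [hcoe, h111, Multiset.coe_replicate]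
    · right; right
      rw [hcoe, h21, ← Multiset.cons_coe, Multiset.coe_replicate]

/-- **LMR 2013, Prop. 3.4.2 at `n = 3` — PROVED**: for `λ ⊢ 3`, `IM_λ ∈ T̂_{[det_3]}𝒟ual_{4,3,9}` iff
`λ = (1,1,1)` or `λ = (2,1)`; the third partition `(3)` is excluded by the certificate
`perPoly_not_mem_lmrZariskiTangent_three` (`IM_{(3)} = per_3`), the two others are included by
`LMR2013_prop_3_4_2_mpr`. [cite: LandsbergManivelRessayre2013, Proposition 3.4.2 (p. 479)] -/
theorem LMR2013_prop_3_4_2_three (lam : Nat.Partition 3) :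
    immanant lam ∈ lmrZariskiTangent (2 * 3 - 2) 3 (detPoly (Fin 3) ℂ) ↔
      lam.parts = Multiset.replicate 3 1 ∨ lam.parts = 2 ::ₘ Multiset.replicate (3 - 2) 1 := by
  refine ⟨fun hmem => ?_, LMR2013_prop_3_4_2_mpr (le_refl 3) lam⟩
  rcases parts_eq_of_partition_three lam with h3 | h
  · exfalso
    rw [immanant_eq_perPoly_of_parts_eq h3] at hmem
    exact perPoly_not_mem_lmrZariskiTangent_three hmem
  · exact h

/-- **Lemma 3.4.1 ⇒ Prop. 3.4.2** (the printed route for `n ≥ 4`, plus the `n = 3` certificate): if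
every `λ ⊢ n`, `n ≥ 4`, with `IM_λ ∈ T̂_{[det_n]}𝒟ual_{2n−2,n,n²}` has its character in the space `C_n`
of four-term class functions (LMR Lemma 3.4.1, typed on `fourTermClassFunctions`), then the named
fact `LMR2013_prop_3_4_2` holds: `dim C_n = 2` forces `λ ∈ {(1ⁿ), (2,1^{n−2})}`
(`spechtCharacter_mem_fourTermClassFunctions_iff`), and `n = 3` is `LMR2013_prop_3_4_2_three`.
[cite: LandsbergManivelRessayre2013, Proposition 3.4.2 (proof, p. 480)] -/
theorem LMR2013_prop_3_4_2_of_lemma_3_4_1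
    (h341 : ∀ n : ℕ, 4 ≤ n → ∀ lam : Nat.Partition n,
      immanant lam ∈ lmrZariskiTangent (2 * n - 2) n (detPoly (Fin n) ℂ) →
        spechtCharacter ℂ lam ∈ fourTermClassFunctions n) :
    LMR2013_prop_3_4_2 := by
  rw [LMR2013_prop_3_4_2_iff_subset]
  intro n hn lam hmem
  rcases Nat.lt_or_ge n 4 with hlt | h4
  · obtain rfl : n = 3 := by omega
    exact (LMR2013_prop_3_4_2_three lam).1 hmem
  · exact (spechtCharacter_mem_fourTermClassFunctions_iff h4 lam).1 (h341 n h4 lam hmem)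

end Literature.Computability.AlgebraicComplexity

end
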